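import Literature.Analysis.FluidPDE.CompressibleEulerImplosionChannelPiece
import Literature.Analysis.FluidPDE.CompressibleEulerImplosionSonicAnalytic
import HarnessLib

/-!
# Buckmaster–Cao-Labora–Gómez-Serrano at `γ = 5/3`: the pinched region at `P_s` (near barriers)

Topic `Literature/Analysis/FluidPDE`; namespace
`Literature.Analysis.FluidPDE.BuckmasterCaolaboraGomezserrano2025.Monatomic`. Companion of
`CompressibleEulerImplosion.lean` (named fact `BuckmasterCaolaboraGomezserrano2025_thm11_monatomic`,
THEOREM 1.1 of T. Buckmaster, G. Cao-Labora, J. Gómez-Serrano, *Smooth imploding solutions for 3D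
compressible fluids*, Forum Math. Pi 13 (2025) e6, arXiv:2208.09445, at `γ = 5/3`). Uses
`CompressibleEulerImplosionChannelPiece.lean` (graph-channel pieces) and
`CompressibleEulerImplosionSonicAnalytic.lean` (the Taylor coefficients `wₙ, zₙ` of the analytic
branch through `P_s`).

The paper leaves `P_s` along *near barriers* osculating the smooth branch to third order (§3,
`b^nl_n(s) = Σ_{i≤n} (W_i, Z_i) sⁱ/i!`, Lemma 3.4, Prop. 3.5; §4, `b^nr_n` with the push-off
`β_n Z_n (−t)^{n+1}/(n+1)!`, Prop. 4.2, Lemmas 4.4, 4.7): all other trajectories through the node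
`P_s` are tangent to the branch to order `⌊k⌋ = 3 < k < 4`, so a confining region must pinch at
`P_s` to order `> k`. Our certificate uses, on BOTH sides of `P_s` and for both signs, the pair of
walls `b±(t) = T_N(t) ± β t⁴ e₂`, where `T_N = (TW, TZ)` is the degree-`N` Taylor polynomial of the
branch and `e₂ = (0, 1)`; inside `|t| ≤ t₁` the region between them is a graph-channel piece in the
straightening coordinates `(t, v) ↦ Φ(t, v) = T_N(t) + v e₂` (`TW′ < 0`), for the desingularised field
`Ĝ = (N_W D_Z, N_Z D_W)` pulled back by `Φ`.

* `TW`, `TZ`, `TW'`, `TZ'`, `Gh` (`Ĝ`), `Phi`, `Ftil` (the pulled-back field) and their calculus;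
* `exists_nearExit`: given the wall and progress sign conditions (the computer-checked part) and a
  starting point `Φ(t₀', v₀)` inside the pinched region, the `Ĝ`-trajectory runs inside the region
  until it reaches the far end `t = ±t₁` (application of `ODE.exists_exit_of_piece_of_subset`).
Theorems + real definitions; no facts.
[cite: BuckmasterCaolaboraGomezserrano2025, §3 (Lemma 3.4, Prop. 3.5), §4 (Prop. 4.2, Lemmas 4.4, 4.7)]
-/

noncomputable section

open Set Filter Metric Topology Finset

namespace Literature.Analysis.FluidPDE

namespace BuckmasterCaolaboraGomezserrano2025

namespace Monatomic

open SonicSeries ODE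

variable {r : ℝ} {N : ℕ}

/-! ### The Taylor polynomials of the branch and the desingularised field -/

/-- `TW(t) = Σ_{n ≤ N} wₙ tⁿ`, the degree-`N` Taylor polynomial of `W^{(r)}` at `P_s`.
[cite: BuckmasterCaolaboraGomezserrano2025, eq. (2.12)] -/
def TW (r : ℝ) (N : ℕ) (t : ℝ) : ℝ := ∑ n ∈ range (N + 1), w r n * t ^ n

/-- `TZ(t) = Σ_{n ≤ N} zₙ tⁿ`. [cite: BuckmasterCaolaboraGomezserrano2025, eq. (2.12)] -/
def TZ (r : ℝ) (N : ℕ) (t : ℝ) : ℝ := ∑ n ∈ range (N + 1), z r n * t ^ n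

/-- The derivative polynomial of `TW`. [folklore] -/
def TW' (r : ℝ) (N : ℕ) (t : ℝ) : ℝ := ∑ n ∈ range (N + 1), w r n * ((n : ℝ) * t ^ (n - 1))

/-- The derivative polynomial of `TZ`. [folklore] -/
def TZ' (r : ℝ) (N : ℕ) (t : ℝ) : ℝ := ∑ n ∈ range (N + 1), z r n * ((n : ℝ) * t ^ (n - 1))

/-- [folklore] -/
theorem hasDerivAt_TW (r : ℝ) (N : ℕ) (t : ℝ) : HasDerivAt (TW r N) (TW' r N t) t := by
  unfold TW TW'
  have := HasDerivAt.fun_sum (u := range (N + 1)) (A := fun n x => w r n * x ^ n)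
    (A' := fun n => w r n * ((n : ℝ) * t ^ (n - 1))) (x := t)
    (fun n _ => (hasDerivAt_pow n t).const_mul (w r n))
  exact this

/-- [folklore] -/
theorem hasDerivAt_TZ (r : ℝ) (N : ℕ) (t : ℝ) : HasDerivAt (TZ r N) (TZ' r N t) t := by
  unfold TZ TZ'
  exact HasDerivAt.fun_sum (u := range (N + 1)) (A := fun n x => z r n * x ^ n)
    (A' := fun n => z r n * ((n : ℝ) * t ^ (n - 1))) (x := t)
    (fun n _ => (hasDerivAt_pow n t).const_mul (z r n))

/-- [folklore] -/
theorem contDiff_TW (r : ℝ) (N : ℕ) : ContDiff ℝ ⊤ (TW r N) := by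
  unfold TW
  exact ContDiff.sum fun n _ => contDiff_const.mul (contDiff_id.pow n)

/-- [folklore] -/
theorem contDiff_TZ (r : ℝ) (N : ℕ) : ContDiff ℝ ⊤ (TZ r N) := by
  unfold TZ
  exact ContDiff.sum fun n _ => contDiff_const.mul (contDiff_id.pow n)

/-- [folklore] -/
theorem contDiff_TW' (r : ℝ) (N : ℕ) : ContDiff ℝ ⊤ (TW' r N) := by
  unfold TW'
  exact ContDiff.sum fun n _ => contDiff_const.mul (contDiff_const.mul (contDiff_id.pow _))

/-- [folklore] -/
theorem contDiff_TZ' (r : ℝ) (N : ℕ) : ContDiff ℝ ⊤ (TZ' r N) := by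
  unfold TZ'
  exact ContDiff.sum fun n _ => contDiff_const.mul (contDiff_const.mul (contDiff_id.pow _))

/-- The desingularised field `Ĝ = (N_W D_Z, N_Z D_W)` of (1.12) (up to sign: we follow `Ĝ` away from
`P_s`). [cite: BuckmasterCaolaboraGomezserrano2025, eq. (1.12)] -/
def Gh (r : ℝ) (x : ℝ × ℝ) : ℝ × ℝ := (NW r x.1 x.2 * DZ x.1 x.2, NZ r x.1 x.2 * DW x.1 x.2)

/-- [folklore] -/
theorem contDiff_Gh (r : ℝ) : ContDiff ℝ ⊤ (Gh r) := by
  unfold Gh NW NZ DW DZ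
  fun_prop

/-- The straightening map `Φ(t, v) = (TW(t), TZ(t) + v)`. [folklore] -/
def Phi (r : ℝ) (N : ℕ) (p : ℝ × ℝ) : ℝ × ℝ := (TW r N p.1, TZ r N p.1 + p.2)

/-- The pulled-back field `Φ^* Ĝ` (where `TW′ ≠ 0`):
`(Ĝ_W/TW′, Ĝ_Z − TZ′ Ĝ_W/TW′)` at `Φ(t, v)`. [folklore] -/
def Ftil (r : ℝ) (N : ℕ) (p : ℝ × ℝ) : ℝ × ℝ :=
  ((Gh r (Phi r N p)).1 / TW' r N p.1,
    (Gh r (Phi r N p)).2 - TZ' r N p.1 * (Gh r (Phi r N p)).1 / TW' r N p.1)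

/-- `Ftil` is `C¹` where `TW′ ≠ 0`. [folklore] -/
theorem contDiffAt_Ftil {p : ℝ × ℝ} (hp : TW' r N p.1 ≠ 0) : ContDiffAt ℝ 1 (Ftil r N) p := by
  have h1 : ContDiffAt ℝ 1 (fun q : ℝ × ℝ => q.1) p := contDiffAt_fst
  have h2 : ContDiffAt ℝ 1 (fun q : ℝ × ℝ => q.2) p := contDiffAt_snd
  have hPhi : ContDiffAt ℝ 1 (Phi r N) p := by
    unfold Phi
    exact (((contDiff_TW r N).of_le le_top).contDiffAt.comp p h1).prodMk
      ((((contDiff_TZ r N).of_le le_top).contDiffAt.comp p h1).add h2)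
  have hG : ContDiffAt ℝ 1 (fun q => Gh r (Phi r N q)) p :=
    ((contDiff_Gh r).of_le le_top).contDiffAt.comp p hPhi
  have hG1 : ContDiffAt ℝ 1 (fun q => (Gh r (Phi r N q)).1) p := hG.fst
  have hG2 : ContDiffAt ℝ 1 (fun q => (Gh r (Phi r N q)).2) p := hG.snd
  have hW' : ContDiffAt ℝ 1 (fun q : ℝ × ℝ => TW' r N q.1) p :=
    ((contDiff_TW' r N).of_le le_top).contDiffAt.comp p h1
  have hZ' : ContDiffAt ℝ 1 (fun q : ℝ × ℝ => TZ' r N q.1) p :=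
    ((contDiff_TZ' r N).of_le le_top).contDiffAt.comp p h1
  unfold Ftil
  exact (hG1.div hW' hp).prodMk (hG2.sub ((hZ'.mul hG1).div hW' hp))

/-- **Push-forward.** If `y = (t, v)` solves `y′ = m • Ftil(y)` at `ψ` and `TW′(t(ψ)) ≠ 0`, then
`x = Φ ∘ y` solves `x′ = m • Ĝ(x)` at `ψ` (the chart is linear in the field). [folklore] -/
theorem hasDerivAt_Phi_comp_smul {y : ℝ → ℝ × ℝ} {ψ m : ℝ}
    (hy : HasDerivAt y (m • Ftil r N (y ψ)) ψ) (hW' : TW' r N (y ψ).1 ≠ 0) :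
    HasDerivAt (fun s => Phi r N (y s)) (m • Gh r (Phi r N (y ψ))) ψ := by
  have ht : HasDerivAt (fun s => (y s).1) (m * (Ftil r N (y ψ)).1) ψ := by
    have h : HasDerivAt (fun s => (y s).1) (m • Ftil r N (y ψ)).1 ψ := hy.fst
    rw [Prod.smul_fst, smul_eq_mul] at h; exact h
  have hv : HasDerivAt (fun s => (y s).2) (m * (Ftil r N (y ψ)).2) ψ := by
    have h : HasDerivAt (fun s => (y s).2) (m • Ftil r N (y ψ)).2 ψ := hy.snd
    rw [Prod.smul_snd, smul_eq_mul] at h; exact h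
  have hW : HasDerivAt (fun s => TW r N ((y s).1)) (TW' r N (y ψ).1 * (m * (Ftil r N (y ψ)).1)) ψ := by
    have := (hasDerivAt_TW r N (y ψ).1).comp ψ ht
    simpa [Function.comp_def] using this
  have hZ : HasDerivAt (fun s => TZ r N ((y s).1) + (y s).2)
      (TZ' r N (y ψ).1 * (m * (Ftil r N (y ψ)).1) + m * (Ftil r N (y ψ)).2) ψ := by
    have := ((hasDerivAt_TZ r N (y ψ).1).comp ψ ht).add hv
    simpa [Function.comp_def, Pi.add_def] using this
  have e1 : TW' r N (y ψ).1 * (m * (Ftil r N (y ψ)).1) = m * (Gh r (Phi r N (y ψ))).1 := by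
    unfold Ftil; field_simp
  have e2 : TZ' r N (y ψ).1 * (m * (Ftil r N (y ψ)).1) + m * (Ftil r N (y ψ)).2 =
      m * (Gh r (Phi r N (y ψ))).2 := by
    unfold Ftil; field_simp; ring
  rw [e1] at hW; rw [e2] at hZ
  unfold Phi
  have e3 : m • Gh r (TW r N (y ψ).1, TZ r N (y ψ).1 + (y ψ).2) =
      (m * (Gh r (TW r N (y ψ).1, TZ r N (y ψ).1 + (y ψ).2)).1,
        m * (Gh r (TW r N (y ψ).1, TZ r N (y ψ).1 + (y ψ).2)).2) := by
    ext <;> simp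
  rw [e3]
  exact hW.prodMk hZ

/-- **Push-forward** (`m = 1`). [folklore] -/
theorem hasDerivAt_Phi_comp {y : ℝ → ℝ × ℝ} {ψ : ℝ} (hy : HasDerivAt y (Ftil r N (y ψ)) ψ)
    (hW' : TW' r N (y ψ).1 ≠ 0) :
    HasDerivAt (fun s => Phi r N (y s)) (Gh r (Phi r N (y ψ))) ψ := by
  have h := hasDerivAt_Phi_comp_smul (m := 1) (by simpa using hy) hW'
  simpa using h

/-! ### The pinched region as a graph-channel piece -/

/-- The upper/lower near walls `b±(t) = (TW(t), TZ(t) ± β t⁴)`.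
[cite: BuckmasterCaolaboraGomezserrano2025, §4 (near barriers `b^nr`)] -/
def bwall (r : ℝ) (N : ℕ) (β σ : ℝ) (t : ℝ) : ℝ × ℝ := (TW r N t, TZ r N t + σ * β * t ^ 4)

/-- The wedge `b′ ∧ Ĝ(b) = b_W′ Ĝ_Z − b_Z′ Ĝ_W` along the wall `b±`:
`TW′ Ĝ_Z − (TZ′ ± 4βt³) Ĝ_W`. [cite: BuckmasterCaolaboraGomezserrano2025, eq. (3.5)/(4.1) (the barrier polynomial `P`)] -/
def wallWedge (r : ℝ) (N : ℕ) (β σ : ℝ) (t : ℝ) : ℝ :=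
  TW' r N t * (Gh r (bwall r N β σ t)).2 - (TZ' r N t + σ * (4 * β * t ^ 3)) * (Gh r (bwall r N β σ t)).1

/-- **Exit through the far end of the pinched region** for a weighted field `G = μ Ĝ`, `μ > 0`
(e.g. `μ ≡ 1`, or `μ = 1/(D_W D_Z)` giving the field (1.8) itself left of `P_s`). Let `s ∈ {±1}`
(the side of `P_s`), `0 < t₁ < t₂`, `β > 0`. Assume: `TW′ < 0` on `[−t₂, t₂]`; along the upper wall
`b⁺(t) = T_N(t) + βt⁴e₂` the wedge `b⁺′ ∧ Ĝ(b⁺)` is positive and along the lower wall `b⁻′ ∧ Ĝ(b⁻)`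
is negative, for `0 < s·t ≤ t₁` (the computer-checked barrier conditions), and `s · Ĝ_W < 0` on the
closed pinched region (progress: `|t|` increases); `μ` is `C¹` on an open set `V` containing the
image of the closed pinched region under `Φ` and positive there. Then from any point `Φ(t₀', v₀)`
with `0 < s t₀' < t₁`, `|v₀| < β t₀'⁴`, the solution `y = (t, v)` of the pulled-back system exists
until `t` reaches `s·t₁`, with `|v| < β t⁴` throughout, and `x = Φ ∘ y` solves `x′ = μ(x) Ĝ(x)`.
[cite: BuckmasterCaolaboraGomezserrano2025, §3 (Lemma 3.4, Prop. 3.5), §4 (Prop. 4.2, Lemmas 4.4, 4.7)] -/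
theorem exists_nearExit_smul {s t₁ t₂ β : ℝ} (hs : s = 1 ∨ s = -1) (ht₁ : 0 < t₁) (ht₁₂ : t₁ < t₂)
    (hTW' : ∀ t ∈ Icc (-t₂) t₂, TW' r N t < 0)
    (hup : ∀ t, 0 < s * t → s * t ≤ t₁ → 0 < wallWedge r N β 1 t)
    (hlo : ∀ t, 0 < s * t → s * t ≤ t₁ → wallWedge r N β (-1) t < 0)
    (hprog : ∀ t v, 0 < s * t → s * t ≤ t₁ → |v| ≤ β * t ^ 4 → s * (Gh r (Phi r N (t, v))).1 < 0)
    {μ : ℝ × ℝ → ℝ} {V : Set (ℝ × ℝ)} (hV : IsOpen V) (hμ : ∀ x ∈ V, ContDiffAt ℝ 1 μ x)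
    (hΦV : ∀ t v, 0 < s * t → s * t ≤ t₁ → |v| ≤ β * t ^ 4 → Phi r N (t, v) ∈ V)
    (hμpos : ∀ t v, 0 < s * t → s * t ≤ t₁ → |v| ≤ β * t ^ 4 → 0 < μ (Phi r N (t, v)))
    {t₀' v₀ : ℝ} (h₀ : 0 < s * t₀') (h₀₁ : s * t₀' < t₁) (hv₀ : |v₀| < β * t₀' ^ 4) :
    ∃ Ψ > (0 : ℝ), ∃ y : ℝ → ℝ × ℝ, y 0 = (t₀', v₀) ∧
      (∀ ψ ∈ Icc 0 Ψ, HasDerivAt y (μ (Phi r N (y ψ)) • Ftil r N (y ψ)) ψ) ∧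
      (∀ ψ ∈ Icc 0 Ψ, HasDerivAt (fun σ => Phi r N (y σ))
        (μ (Phi r N (y ψ)) • Gh r (Phi r N (y ψ))) ψ) ∧
      (∀ ψ ∈ Icc 0 Ψ, s * t₀' / 2 ≤ s * (y ψ).1 ∧ s * (y ψ).1 ≤ t₁ ∧ |(y ψ).2| < β * (y ψ).1 ^ 4) ∧
      (y Ψ).1 = s * t₁ := by
  have hs2 : s * s = 1 := by rcases hs with h | h <;> rw [h] <;> norm_num
  have hs4 : ∀ t : ℝ, (s * t) ^ 4 = t ^ 4 := fun t => by
    have : (s * t) ^ 4 = (s * s) ^ 2 * t ^ 4 := by ring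
    rw [this, hs2]; ring
  have hs3 : ∀ t : ℝ, (s * t) ^ 3 = s * t ^ 3 := fun t => by
    have : (s * t) ^ 3 = (s * s) * s * t ^ 3 := by ring
    rw [this, hs2]; ring
  -- the chart `u = s t`, `v = v`
  set ch : LinChart := ⟨s, 0, 0, 1⟩ with hch
  have hu : ∀ p : ℝ × ℝ, ch.u p = s * p.1 := fun p => by simp [LinChart.u, hch]
  have hv : ∀ p : ℝ × ℝ, ch.v p = p.2 := fun p => by simp [LinChart.v, hch]
  have hdet : ch.a * ch.d - ch.b * ch.c ≠ 0 := by
    simp only [hch]; rcases hs with h | h <;> rw [h] <;> norm_num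
  set ua : ℝ := s * t₀' / 2 with hua
  have hua0 : 0 < ua := by rw [hua]; linarith
  have huab : ua < t₁ := by rw [hua]; linarith
  set fL : ℝ → ℝ := fun u => β * u ^ 4 with hfL
  set fR : ℝ → ℝ := fun u => -(β * u ^ 4) with hfR
  set fL' : ℝ → ℝ := fun u => β * (4 * u ^ 3) with hfL'
  set fR' : ℝ → ℝ := fun u => -(β * (4 * u ^ 3)) with hfR'
  have hdL : ∀ u, HasDerivAt fL (fL' u) u := fun u => by
    simpa [hfL, hfL'] using ((hasDerivAt_pow 4 u).const_mul β)
  have hdR : ∀ u, HasDerivAt fR (fR' u) u := fun u => by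
    have := ((hasDerivAt_pow 4 u).const_mul β).neg
    simpa [hfR, hfR', Pi.neg_def] using this
  -- the weighted pulled-back field and the open set where the chart is good
  set F : ℝ × ℝ → ℝ × ℝ := fun p => μ (Phi r N p) • Ftil r N p with hF
  have hPhic : Continuous (Phi r N) := by
    unfold Phi
    exact ((contDiff_TW r N).continuous.comp continuous_fst).prodMk
      (((contDiff_TZ r N).continuous.comp continuous_fst).add continuous_snd)
  set U : Set (ℝ × ℝ) := {p | p.1 ∈ Ioo (-t₂) t₂} ∩ Phi r N ⁻¹' V with hU
  have hUo : IsOpen U := (isOpen_Ioo.preimage continuous_fst).inter (hV.preimage hPhic)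
  have hFU : ∀ p ∈ U, ContDiffAt ℝ 1 F p := by
    intro p hp
    have h1 : ContDiffAt ℝ 1 (Ftil r N) p := contDiffAt_Ftil (hTW' p.1 ⟨hp.1.1.le, hp.1.2.le⟩).ne
    have hPhi : ContDiffAt ℝ 1 (Phi r N) p := by
      unfold Phi
      exact (((contDiff_TW r N).of_le le_top).contDiffAt.comp p contDiffAt_fst).prodMk
        ((((contDiff_TZ r N).of_le le_top).contDiffAt.comp p contDiffAt_fst).add contDiffAt_snd)
    have h2 : ContDiffAt ℝ 1 (fun q => μ (Phi r N q)) p := (hμ _ hp.2).comp p hPhi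
    exact h2.smul h1
  have hF1 : ∀ p, (F p).1 = μ (Phi r N p) * (Ftil r N p).1 := fun p => by simp [hF]
  have hF2 : ∀ p, (F p).2 = μ (Phi r N p) * (Ftil r N p).2 := fun p => by simp [hF]
  -- points of the piece: `s t ∈ [ua, t₁]` so `|t| ≤ t₁ < t₂`
  have hst_abs : ∀ t : ℝ, |s * t| = |t| := fun t => by
    rw [abs_mul]; rcases hs with h | h <;> rw [h] <;> simp
  have ht_of_u : ∀ t : ℝ, s * t ∈ Icc ua t₁ → 0 < s * t ∧ s * t ≤ t₁ ∧ t ∈ Icc (-t₂) t₂ := by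
    intro t ht
    refine ⟨hua0.trans_le ht.1, ht.2, ?_⟩
    have : |t| ≤ t₁ := by rw [← hst_abs]; exact abs_le.2 ⟨by linarith [ht.1], ht.2⟩
    exact ⟨by linarith [(abs_le.1 this).1], by linarith [(abs_le.1 this).2]⟩
  -- points of the piece are points of the pinched region
  have hreg : ∀ p ∈ piece ch ua t₁ fL fR, 0 < s * p.1 ∧ s * p.1 ≤ t₁ ∧ |p.2| ≤ β * p.1 ^ 4 := by
    intro p hp
    obtain ⟨hpu, hR, hL⟩ := hp
    rw [hu] at hpu; rw [hv, hu] at hR hL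
    obtain ⟨h1, h2, -⟩ := ht_of_u p.1 hpu
    simp only [hfL, hfR, hs4] at hR hL
    exact ⟨h1, h2, abs_le.2 ⟨by linarith, hL⟩⟩
  have hμp : ∀ p ∈ piece ch ua t₁ fL fR, 0 < μ (Phi r N p) := fun p hp => by
    obtain ⟨h1, h2, h3⟩ := hreg p hp
    exact hμpos p.1 p.2 h1 h2 h3
  have hKU : piece ch ua t₁ fL fR ⊆ U := fun p hp => by
    have hp' := hp
    obtain ⟨hpu, -, -⟩ := hp
    rw [hu] at hpu
    obtain ⟨h1, h2, hI⟩ := ht_of_u p.1 hpu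
    have : |p.1| ≤ t₁ := by rw [← hst_abs]; exact abs_le.2 ⟨by linarith [hpu.1], hpu.2⟩
    refine ⟨⟨by linarith [(abs_le.1 this).1], by linarith [(abs_le.1 this).2]⟩, ?_⟩
    obtain ⟨-, -, h3⟩ := hreg p hp'
    exact hΦV p.1 p.2 h1 h2 h3
  -- wall conditions in the chart
  have key : ∀ (σ : ℝ) (p : ℝ × ℝ), p.2 = σ * β * p.1 ^ 4 → TW' r N p.1 ≠ 0 →
      (Ftil r N p).2 - σ * (4 * β * p.1 ^ 3) * (Ftil r N p).1 = wallWedge r N β σ p.1 / TW' r N p.1 := by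
    intro σ p hp2 hW
    have hPhi : Phi r N p = bwall r N β σ p.1 := by
      unfold Phi bwall; rw [hp2]
    unfold Ftil wallWedge
    rw [hPhi]
    field_simp
    ring
  have hβ : 0 < β := by
    by_contra hβ
    have : β * t₀' ^ 4 ≤ 0 := mul_nonpos_of_nonpos_of_nonneg (not_lt.1 hβ) (by positivity)
    linarith [abs_nonneg v₀]
  have hwall_mem : ∀ (σ : ℝ) (p : ℝ × ℝ), σ = 1 ∨ σ = -1 → ch.u p ∈ Icc ua t₁ →
      p.2 = σ * β * p.1 ^ 4 → p ∈ piece ch ua t₁ fL fR := by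
    intro σ p hσ hpu hp2
    refine ⟨hpu, ?_, ?_⟩
    · rw [hv, hu]; simp only [hfR, hs4, hp2]
      have : 0 ≤ β * p.1 ^ 4 := by positivity
      rcases hσ with h | h <;> rw [h] <;> linarith
    · rw [hv, hu]; simp only [hfL, hs4, hp2]
      have : 0 ≤ β * p.1 ^ 4 := by positivity
      rcases hσ with h | h <;> rw [h] <;> linarith
  have hwallL : ∀ p : ℝ × ℝ, ch.u p ∈ Icc ua t₁ → ch.v p = fL (ch.u p) →
      ch.v (F p) - fL' (ch.u p) * ch.u (F p) < 0 := by
    intro p hpu hpv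
    have hpu' := hpu
    rw [hu] at hpu; rw [hu, hv] at hpv
    obtain ⟨h1, h2, hI⟩ := ht_of_u p.1 hpu
    have hW := hTW' p.1 hI
    have hp2 : p.2 = 1 * β * p.1 ^ 4 := by rw [hpv, hfL]; simp [hs4]
    have hk := key 1 p hp2 hW.ne
    have hm := hμp p (hwall_mem 1 p (Or.inl rfl) hpu' hp2)
    rw [hv, hu, hu, hF2, hF1]
    simp only [hfL']
    have e : μ (Phi r N p) * (Ftil r N p).2 - β * (4 * (s * p.1) ^ 3) * (s * (μ (Phi r N p) *
        (Ftil r N p).1)) = μ (Phi r N p) * ((Ftil r N p).2 - 1 * (4 * β * p.1 ^ 3) * (Ftil r N p).1) := by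
      rw [hs3]; linear_combination (-(4 * β * p.1 ^ 3 * (Ftil r N p).1 * μ (Phi r N p))) * hs2
    rw [e, hk]
    exact mul_neg_of_pos_of_neg hm (div_neg_of_pos_of_neg (hup p.1 h1 h2) hW)
  have hwallR : ∀ p : ℝ × ℝ, ch.u p ∈ Icc ua t₁ → ch.v p = fR (ch.u p) →
      0 < ch.v (F p) - fR' (ch.u p) * ch.u (F p) := by
    intro p hpu hpv
    have hpu' := hpu
    rw [hu] at hpu; rw [hu, hv] at hpv
    obtain ⟨h1, h2, hI⟩ := ht_of_u p.1 hpu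
    have hW := hTW' p.1 hI
    have hp2 : p.2 = (-1) * β * p.1 ^ 4 := by rw [hpv, hfR]; simp [hs4]
    have hk := key (-1) p hp2 hW.ne
    have hm := hμp p (hwall_mem (-1) p (Or.inr rfl) hpu' hp2)
    rw [hv, hu, hu, hF2, hF1]
    simp only [hfR']
    have e : μ (Phi r N p) * (Ftil r N p).2 - -(β * (4 * (s * p.1) ^ 3)) * (s * (μ (Phi r N p) *
        (Ftil r N p).1)) = μ (Phi r N p) * ((Ftil r N p).2 - (-1) * (4 * β * p.1 ^ 3) * (Ftil r N p).1) := by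
      rw [hs3]; linear_combination (4 * β * p.1 ^ 3 * (Ftil r N p).1 * μ (Phi r N p)) * hs2
    rw [e, hk]
    exact mul_pos hm (div_pos_of_neg_of_neg (hlo p.1 h1 h2) hW)
  have hprog' : ∀ p ∈ piece ch ua t₁ fL fR, 0 < ch.u (F p) := by
    intro p hp
    have hm := hμp p hp
    obtain ⟨h1, h2, habs⟩ := hreg p hp
    obtain ⟨hpu, -, -⟩ := hp
    rw [hu] at hpu ⊢
    obtain ⟨-, -, hI⟩ := ht_of_u p.1 hpu
    have hW := hTW' p.1 hI
    have hg := hprog p.1 p.2 h1 h2 habs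
    have hPhi : Phi r N p = Phi r N (p.1, p.2) := rfl
    rw [hF1]
    have : 0 < s * (Ftil r N p).1 := by
      unfold Ftil
      simp only
      rw [mul_div_assoc']
      exact div_pos_of_neg_of_neg (by rw [← hPhi] at hg; linarith [hg]) hW
    nlinarith
  -- the starting point
  have hu₀ : ch.u (t₀', v₀) ∈ Ico ua t₁ := by
    rw [hu]; exact ⟨by rw [hua]; linarith, h₀₁⟩
  have hv₀' : fR (ch.u (t₀', v₀)) < ch.v (t₀', v₀) ∧ ch.v (t₀', v₀) < fL (ch.u (t₀', v₀)) := by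
    rw [hu, hv]; simp only [hfL, hfR, hs4]
    exact ⟨by linarith [(abs_lt.1 hv₀).1], (abs_lt.1 hv₀).2⟩
  obtain ⟨Ψ, hΨ, y, hy0, hyd, hyin, hyend⟩ := exists_exit_of_piece_of_subset hUo hFU hdet huab
    hdL hdR hwallL hwallR hprog' hKU hu₀ hv₀'
  refine ⟨Ψ, hΨ, y, hy0, fun ψ hψ => by simpa [hF] using hyd ψ hψ, fun ψ hψ => ?_,
    fun ψ hψ => ?_, ?_⟩
  · have hmem := hyin ψ hψ
    rw [hu] at hmem
    obtain ⟨-, -, hI⟩ := ht_of_u _ hmem.1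
    exact hasDerivAt_Phi_comp_smul (by simpa [hF] using hyd ψ hψ) (hTW' _ hI).ne
  · have hmem := hyin ψ hψ
    rw [hu, hv] at hmem
    simp only [hfL, hfR, hs4] at hmem
    exact ⟨hmem.1.1, hmem.1.2, abs_lt.2 ⟨by linarith [hmem.2.1], hmem.2.2⟩⟩
  · have h := hyend; rw [hu] at h
    -- `s * t = t₁` gives `t = s * t₁` since `s² = 1`
    calc (y Ψ).1 = s * (s * (y Ψ).1) := by rw [← mul_assoc, hs2, one_mul]
      _ = s * t₁ := by rw [h]


/-- **Exit through the far end of the pinched region** for the desingularised field `Ĝ` itself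
(`μ ≡ 1`); see `exists_nearExit_smul`.
[cite: BuckmasterCaolaboraGomezserrano2025, §3 (Lemma 3.4, Prop. 3.5), §4 (Prop. 4.2, Lemmas 4.4, 4.7)] -/
theorem exists_nearExit {s t₁ t₂ β : ℝ} (hs : s = 1 ∨ s = -1) (ht₁ : 0 < t₁) (ht₁₂ : t₁ < t₂)
    (hTW' : ∀ t ∈ Icc (-t₂) t₂, TW' r N t < 0)
    (hup : ∀ t, 0 < s * t → s * t ≤ t₁ → 0 < wallWedge r N β 1 t)
    (hlo : ∀ t, 0 < s * t → s * t ≤ t₁ → wallWedge r N β (-1) t < 0)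
    (hprog : ∀ t v, 0 < s * t → s * t ≤ t₁ → |v| ≤ β * t ^ 4 → s * (Gh r (Phi r N (t, v))).1 < 0)
    {t₀' v₀ : ℝ} (h₀ : 0 < s * t₀') (h₀₁ : s * t₀' < t₁) (hv₀ : |v₀| < β * t₀' ^ 4) :
    ∃ Ψ > (0 : ℝ), ∃ y : ℝ → ℝ × ℝ, y 0 = (t₀', v₀) ∧
      (∀ ψ ∈ Icc 0 Ψ, HasDerivAt y (Ftil r N (y ψ)) ψ) ∧
      (∀ ψ ∈ Icc 0 Ψ, HasDerivAt (fun σ => Phi r N (y σ)) (Gh r (Phi r N (y ψ))) ψ) ∧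
      (∀ ψ ∈ Icc 0 Ψ, s * t₀' / 2 ≤ s * (y ψ).1 ∧ s * (y ψ).1 ≤ t₁ ∧ |(y ψ).2| < β * (y ψ).1 ^ 4) ∧
      (y Ψ).1 = s * t₁ := by
  obtain ⟨Ψ, hΨ, y, hy0, hyd, hxd, hyin, hyend⟩ := exists_nearExit_smul (μ := fun _ => (1 : ℝ))
    (V := univ) hs ht₁ ht₁₂ hTW' hup hlo hprog isOpen_univ (fun _ _ => contDiffAt_const)
    (fun _ _ _ _ _ => mem_univ _) (fun _ _ _ _ _ => one_pos) h₀ h₀₁ hv₀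
  exact ⟨Ψ, hΨ, y, hy0, fun ψ hψ => by simpa using hyd ψ hψ, fun ψ hψ => by simpa using hxd ψ hψ,
    hyin, hyend⟩

/-- Off the sonic lines the field (1.8) is `Ĝ/(D_W D_Z)`. [folklore] -/
theorem field_eq_smul_Gh {x : ℝ × ℝ} (hW : DW x.1 x.2 ≠ 0) (hZ : DZ x.1 x.2 ≠ 0) :
    field r x = (DW x.1 x.2 * DZ x.1 x.2)⁻¹ • Gh r x := by
  unfold field Gh
  ext <;> simp <;> field_simp

/-- **Exit through the far end of the pinched region, as a solution of (1.8)** (left of `P_s`,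
where `D_W, D_Z > 0` on the region, so that the field (1.8) is the positive multiple `Ĝ/(D_W D_Z)`
of `Ĝ`): the hypotheses of `exists_nearExit` plus `D_W > 0`, `D_Z > 0` on the closed pinched
region. [cite: BuckmasterCaolaboraGomezserrano2025, Prop. 3.1, Lemma 3.4, Prop. 3.5] -/
theorem exists_nearExit_field {s t₁ t₂ β : ℝ} (hs : s = 1 ∨ s = -1) (ht₁ : 0 < t₁) (ht₁₂ : t₁ < t₂)
    (hTW' : ∀ t ∈ Icc (-t₂) t₂, TW' r N t < 0)
    (hup : ∀ t, 0 < s * t → s * t ≤ t₁ → 0 < wallWedge r N β 1 t)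
    (hlo : ∀ t, 0 < s * t → s * t ≤ t₁ → wallWedge r N β (-1) t < 0)
    (hprog : ∀ t v, 0 < s * t → s * t ≤ t₁ → |v| ≤ β * t ^ 4 → s * (Gh r (Phi r N (t, v))).1 < 0)
    (hDW : ∀ t v, 0 < s * t → s * t ≤ t₁ → |v| ≤ β * t ^ 4 →
      0 < DW (Phi r N (t, v)).1 (Phi r N (t, v)).2)
    (hDZ : ∀ t v, 0 < s * t → s * t ≤ t₁ → |v| ≤ β * t ^ 4 →
      0 < DZ (Phi r N (t, v)).1 (Phi r N (t, v)).2)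
    {t₀' v₀ : ℝ} (h₀ : 0 < s * t₀') (h₀₁ : s * t₀' < t₁) (hv₀ : |v₀| < β * t₀' ^ 4) :
    ∃ Ψ > (0 : ℝ), ∃ y : ℝ → ℝ × ℝ, y 0 = (t₀', v₀) ∧
      (∀ ψ ∈ Icc 0 Ψ, HasDerivAt (fun σ => Phi r N (y σ)) (field r (Phi r N (y ψ))) ψ) ∧
      (∀ ψ ∈ Icc 0 Ψ, s * t₀' / 2 ≤ s * (y ψ).1 ∧ s * (y ψ).1 ≤ t₁ ∧ |(y ψ).2| < β * (y ψ).1 ^ 4) ∧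
      (y Ψ).1 = s * t₁ := by
  have hμ : ∀ x ∈ offSonic, ContDiffAt ℝ 1 (fun x : ℝ × ℝ => (DW x.1 x.2 * DZ x.1 x.2)⁻¹) x := by
    intro x hx
    have h : ContDiffAt ℝ 1 (fun x : ℝ × ℝ => DW x.1 x.2 * DZ x.1 x.2) x := by
      unfold DW DZ; fun_prop
    exact h.inv (mul_ne_zero hx.1 hx.2)
  obtain ⟨Ψ, hΨ, y, hy0, -, hxd, hyin, hyend⟩ := exists_nearExit_smul
    (μ := fun x : ℝ × ℝ => (DW x.1 x.2 * DZ x.1 x.2)⁻¹) (V := offSonic) hs ht₁ ht₁₂ hTW' hup hlo hprog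
    isOpen_offSonic hμ (fun t v h1 h2 h3 => ⟨(hDW t v h1 h2 h3).ne', (hDZ t v h1 h2 h3).ne'⟩)
    (fun t v h1 h2 h3 => by
      have := hDW t v h1 h2 h3; have := hDZ t v h1 h2 h3; positivity) h₀ h₀₁ hv₀
  refine ⟨Ψ, hΨ, y, hy0, fun ψ hψ => ?_, hyin, hyend⟩
  have h := hxd ψ hψ
  obtain ⟨h1, h2, h3⟩ := hyin ψ hψ
  have h1' : 0 < s * (y ψ).1 := by
    have hs0 : 0 ≤ s * t₀' / 2 := by linarith
    rcases eq_or_lt_of_le (hs0.trans h1) with h | h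
    · -- `s (y ψ).1 = 0` would give `|v| < 0`
      exfalso
      have ht0 : (y ψ).1 = 0 := by
        rcases hs with hh | hh <;> rw [hh] at h <;> linarith
      rw [ht0] at h3; simp at h3; linarith [abs_nonneg (y ψ).2]
    · exact h
  have e := field_eq_smul_Gh (r := r) (hDW (y ψ).1 (y ψ).2 h1' h2 h3.le).ne'
    (hDZ (y ψ).1 (y ψ).2 h1' h2 h3.le).ne'
  rw [e]
  exact h

/-! ### Entering the pinched region along the analytic branch

The analytic branch `B(t) = (W^{(r)}(t), Z^{(r)}(t)) = (Σ wₙtⁿ, Σ zₙtⁿ)` (`|t| < sonicRad r`) deviates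
from its Taylor polynomial `T_N` by `O(t^{N+1})`, quantitatively by the geometric coefficient bound
`|wₙ| + |zₙ| ≤ geoK · geoMⁿ` of Proposition 2.3; hence for `N ≥ 4` and `t₀ = ±η` small it lies inside
the pinched region `|v| < β t⁴` of the straightening chart. -/

/-- Tail of a geometrically dominated power series: `|Σ' fₙ ξⁿ − Σ_{n<L} fₙ ξⁿ| ≤ 2K (M|ξ|)^L`
when `|fₙ| ≤ K Mⁿ` and `M|ξ| ≤ 1/2`. [folklore] -/
theorem abs_tsum_sub_sum_le {f : ℕ → ℝ} {K M : ℝ} (hf : ∀ n, |f n| ≤ K * M ^ n) (hM : 0 ≤ M)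
    {ξ : ℝ} (hξ : M * |ξ| ≤ 1 / 2) (L : ℕ) :
    |∑' n, f n * ξ ^ n - ∑ n ∈ range L, f n * ξ ^ n| ≤ 2 * K * (M * |ξ|) ^ L := by
  have hK : 0 ≤ K := SonicSeries.nonneg_of_bound hf
  have hsum : Summable fun n => f n * ξ ^ n := (SonicSeries.summable_norm_term hf hM hξ).of_norm
  have hsplit := hsum.sum_add_tsum_nat_add L
  have htail : ∑' n, f n * ξ ^ n - ∑ n ∈ range L, f n * ξ ^ n = ∑' n, f (n + L) * ξ ^ (n + L) := by
    linarith
  rw [htail]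
  -- termwise bound by the geometric series `K (M|ξ|)^L (1/2)^n`
  have hterm : ∀ n, ‖f (n + L) * ξ ^ (n + L)‖ ≤ K * (M * |ξ|) ^ L * (1 / 2) ^ n := by
    intro n
    rw [Real.norm_eq_abs, abs_mul, abs_pow]
    have h0 : 0 ≤ K * (M * |ξ|) ^ L := by positivity
    calc |f (n + L)| * |ξ| ^ (n + L) ≤ K * M ^ (n + L) * |ξ| ^ (n + L) :=
          mul_le_mul_of_nonneg_right (hf _) (by positivity)
      _ = K * (M * |ξ|) ^ L * (M * |ξ|) ^ n := by
          rw [mul_assoc K, ← mul_pow, pow_add, mul_comm (_ ^ n), mul_assoc]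
      _ ≤ K * (M * |ξ|) ^ L * (1 / 2) ^ n :=
          mul_le_mul_of_nonneg_left (pow_le_pow_left₀ (by positivity) hξ n) h0
  have hgeo : HasSum (fun n : ℕ => K * (M * |ξ|) ^ L * (1 / 2 : ℝ) ^ n) (K * (M * |ξ|) ^ L * 2) := by
    have h := (hasSum_geometric_of_lt_one (r := (1 / 2 : ℝ)) (by norm_num) (by norm_num)).mul_left
      (K * (M * |ξ|) ^ L)
    norm_num at h
    exact h
  have hsumm : Summable fun n => ‖f (n + L) * ξ ^ (n + L)‖ :=
    Summable.of_nonneg_of_le (fun n => norm_nonneg _) hterm hgeo.summable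
  calc |∑' n, f (n + L) * ξ ^ (n + L)| = ‖∑' n, f (n + L) * ξ ^ (n + L)‖ := (Real.norm_eq_abs _).symm
    _ ≤ ∑' n, ‖f (n + L) * ξ ^ (n + L)‖ := norm_tsum_le_tsum_norm hsumm
    _ ≤ ∑' n : ℕ, K * (M * |ξ|) ^ L * (1 / 2 : ℝ) ^ n := hsumm.tsum_le_tsum hterm hgeo.summable
    _ = K * (M * |ξ|) ^ L * 2 := hgeo.tsum_eq
    _ = 2 * K * (M * |ξ|) ^ L := by ring

set_option maxHeartbeats 1600000 in
/-- **Entering the pinched region.** Let `r ∈ (r₃, r₄)`, `N ≥ 4`, `s = ±1`, and constants with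
`geoK r ≤ K₀`, `geoM r ≤ M₀`, `TW′ ≤ −μ₀ < 0` and `|TZ′| ≤ L` on `[−t₂, t₂]`, `t₁ < t₂`, together with
the explicit smallness conditions below (written at the largest admissible `η₀ = 1/(2048 M₀)`). Then
for every `0 < η ≤ η₀` the branch point `B(s η)` is a point `Φ(t₀', v₀)` of the pinched region:
`0 < s t₀' < t₁`, `|v₀| < β t₀'⁴`; moreover `η < sonicRad r`.
[cite: BuckmasterCaolaboraGomezserrano2025, Prop. 2.3, Lemma 3.4, Lemma 4.7] -/
theorem exists_nearStart (h3 : r3 < r) (h4 : r < r4) (hN : 4 ≤ N) {s : ℝ} (hs : s = 1 ∨ s = -1)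
    {K₀ M₀ μ₀ L t₁ t₂ β : ℝ} (hK : geoK r ≤ K₀) (hM : geoM r ≤ M₀) (hμ : 0 < μ₀) (hL0 : 0 ≤ L)
    (ht₁₂ : t₁ < t₂)
    (hTW' : ∀ t ∈ Icc (-t₂) t₂, TW' r N t ≤ -μ₀) (hTZ' : ∀ t ∈ Icc (-t₂) t₂, |TZ' r N t| ≤ L)
    (hη₀ : 2 * (1 / (2048 * M₀)) ≤ t₁)
    (hsmall : 32 * K₀ * (1 + L / μ₀) * M₀ ^ 4 < β * 2048 ^ (N - 3))
    (hE₁ : 2 * K₀ * (1 / 2048) ^ (N + 1) ≤ μ₀ * (1 / (4096 * M₀)))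
    (hE₂ : 2 * K₀ * (1 / 2048) ^ (N + 1) < μ₀ * (t₂ - 1 / (2048 * M₀)))
    {η : ℝ} (hη : 0 < η) (hηle : η ≤ 1 / (2048 * M₀)) :
    ∃ t₀' v₀ : ℝ, TW r N t₀' = Wloc r (s * η) ∧
      TZ r N t₀' + v₀ = Zloc r (s * η) ∧
      0 < s * t₀' ∧ s * t₀' < t₁ ∧ |v₀| < β * t₀' ^ 4 ∧
      |s * η| < sonicRad r ∧ t₀' ∈ Icc (-t₂) t₂ := by
  have hr : r < rstar := h4.trans r3_r4_mem.2.2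
  have hgM : 4 ≤ geoM r := four_le_geoM hr
  have hgK : 0 < geoK r := geoK_pos r
  have hM0 : 0 < M₀ := by linarith
  have hK0 : 0 < K₀ := by linarith
  have hη0 : η ≤ 1 / (2048 * M₀) := hηle
  have hMη1 : M₀ * η ≤ 1 / 2048 := by
    have h := mul_le_mul_of_nonneg_left hη0 hM0.le
    have e : M₀ * (1 / (2048 * M₀)) = 1 / 2048 := by field_simp
    linarith
  set t₀ : ℝ := s * η with ht₀
  have hs1 : |s| = 1 := by rcases hs with h | h <;> rw [h] <;> norm_num
  have hs2 : s * s = 1 := by rcases hs with h | h <;> rw [h] <;> norm_num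
  have habs0 : |t₀| = η := by rw [ht₀, abs_mul, hs1, one_mul, abs_of_pos hη]
  have hst₀ : s * t₀ = η := by rw [ht₀, ← mul_assoc, hs2, one_mul]
  -- geometric data
  have hMη' : geoM r * |t₀| ≤ M₀ * η := by rw [habs0]; gcongr
  have hMη : geoM r * |t₀| ≤ 1 / 2 := by linarith
  have hb : ∀ n, av r n ≤ geoK r * geoM r ^ n := av_le_geom h3 h4
  have hw : ∀ n, |w r n| ≤ geoK r * geoM r ^ n := fun n => (abs_w_le_av n).trans (hb n)
  have hz : ∀ n, |z r n| ≤ geoK r * geoM r ^ n := fun n => (abs_z_le_av n).trans (hb n)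
  have hgM0 : 0 ≤ geoM r := by linarith
  -- the deviation bound `E = 2 K₀ (M₀ η)^{N+1}` and the three facts about it
  obtain ⟨m, hm⟩ : ∃ m : ℕ, N = m + 3 := ⟨N - 3, by omega⟩
  have hm' : N - 3 = m := by omega
  rw [hm'] at hsmall
  set E : ℝ := 2 * K₀ * (M₀ * η) ^ (N + 1) with hEdef
  have hMη0 : 0 ≤ M₀ * η := by positivity
  have hE0 : 0 ≤ E := by rw [hEdef]; positivity
  have hpowle : ∀ k : ℕ, (M₀ * η) ^ k ≤ (1 / 2048) ^ k := fun k => pow_le_pow_left₀ hMη0 hMη1 k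
  -- (1) `E ≤ μ₀ η / 2`
  have hEμ : E ≤ μ₀ * (η / 2) := by
    have e : E = 2 * K₀ * (M₀ * η) ^ N * M₀ * η := by rw [hEdef, pow_succ]; ring
    have h1 : 2 * K₀ * (M₀ * η) ^ N * M₀ * η ≤ 2 * K₀ * (1 / 2048) ^ N * M₀ * η := by
      have := hpowle N
      have : 2 * K₀ * (M₀ * η) ^ N ≤ 2 * K₀ * (1 / 2048) ^ N := by gcongr
      exact mul_le_mul_of_nonneg_right (mul_le_mul_of_nonneg_right this hM0.le) hη.le
    have h2 : 2 * K₀ * (1 / 2048) ^ N * M₀ ≤ μ₀ / 2 := by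
      -- from `hE₁`, multiplying by `2048 M₀`
      have e1 : 2 * K₀ * (1 / 2048 : ℝ) ^ (N + 1) * (2048 * M₀) = 2 * K₀ * (1 / 2048) ^ N * M₀ := by
        rw [pow_succ]; ring
      have e2 : μ₀ * (1 / (4096 * M₀)) * (2048 * M₀) = μ₀ / 2 := by field_simp; ring
      have := mul_le_mul_of_nonneg_right hE₁ (show (0 : ℝ) ≤ 2048 * M₀ by positivity)
      rw [e1, e2] at this; exact this
    rw [e]
    nlinarith
  -- (2) `E < μ₀ (t₂ - η)`
  have hE₂' : E < μ₀ * (t₂ - η) := by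
    have h1 : E ≤ 2 * K₀ * (1 / 2048) ^ (N + 1) := by
      rw [hEdef]; gcongr
    have h2 : μ₀ * (t₂ - 1 / (2048 * M₀)) ≤ μ₀ * (t₂ - η) := by
      exact mul_le_mul_of_nonneg_left (by linarith) hμ.le
    linarith
  have hdevW : |Wloc r t₀ - TW r N t₀| ≤ E := by
    have h := abs_tsum_sub_sum_le hw hgM0 hMη (N + 1)
    rw [Wloc_def]; unfold TW
    refine h.trans ?_
    rw [hEdef]
    have h1 : (geoM r * |t₀|) ^ (N + 1) ≤ (M₀ * η) ^ (N + 1) :=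
      pow_le_pow_left₀ (by positivity) hMη' _
    have h2 : 2 * geoK r * (geoM r * |t₀|) ^ (N + 1) ≤ 2 * K₀ * (geoM r * |t₀|) ^ (N + 1) := by
      gcongr
    nlinarith [pow_nonneg (by positivity : 0 ≤ geoM r * |t₀|) (N + 1)]
  have hdevZ : |Zloc r t₀ - TZ r N t₀| ≤ E := by
    have h := abs_tsum_sub_sum_le hz hgM0 hMη (N + 1)
    rw [Zloc_def]; unfold TZ
    refine h.trans ?_
    rw [hEdef]
    have h1 : (geoM r * |t₀|) ^ (N + 1) ≤ (M₀ * η) ^ (N + 1) :=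
      pow_le_pow_left₀ (by positivity) hMη' _
    have h2 : 2 * geoK r * (geoM r * |t₀|) ^ (N + 1) ≤ 2 * K₀ * (geoM r * |t₀|) ^ (N + 1) := by
      gcongr
    nlinarith [pow_nonneg (by positivity : 0 ≤ geoM r * |t₀|) (N + 1)]
  -- monotonicity of `TW` on `[-t₂, t₂]` with slope `≤ -μ₀`
  have hcont : ContinuousOn (TW r N) (Icc (-t₂) t₂) := (contDiff_TW r N).continuous.continuousOn
  have hdiff : DifferentiableOn ℝ (TW r N) (interior (Icc (-t₂) t₂)) :=
    fun t _ => (hasDerivAt_TW r N t).differentiableAt.differentiableWithinAt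
  have hder : ∀ t ∈ interior (Icc (-t₂) t₂), deriv (TW r N) t ≤ -μ₀ := by
    intro t ht; rw [interior_Icc] at ht
    rw [(hasDerivAt_TW r N t).deriv]; exact hTW' t ⟨ht.1.le, ht.2.le⟩
  have hslope : ∀ a b, a ∈ Icc (-t₂) t₂ → b ∈ Icc (-t₂) t₂ → a ≤ b →
      TW r N b - TW r N a ≤ -μ₀ * (b - a) := fun a b ha hb hab =>
    (convex_Icc (-t₂) t₂).image_sub_le_mul_sub_of_deriv_le hcont hdiff hder a ha b hb hab
  have hηt₁ : 2 * η ≤ t₁ := by linarith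
  have ht₀I : t₀ ∈ Icc (-t₂) t₂ := by
    have : |t₀| ≤ t₂ := by rw [habs0]; linarith
    exact ⟨by linarith [(abs_le.1 this).1], (abs_le.1 this).2⟩
  have ht₂0 : 0 < t₂ := by linarith
  -- the value `Wloc t₀` lies between `TW t₂` and `TW (-t₂)`
  have hlow : TW r N t₂ ≤ Wloc r t₀ := by
    have h1 := hslope t₀ t₂ ht₀I ⟨by linarith [ht₂0], le_rfl⟩ ht₀I.2
    have hgap : μ₀ * (t₂ - η) ≤ μ₀ * (t₂ - t₀) := by
      have : t₀ ≤ η := by rw [← habs0]; exact le_abs_self t₀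
      exact mul_le_mul_of_nonneg_left (by linarith) hμ.le
    have h3 := (abs_le.1 hdevW).1
    linarith
  have hhigh : Wloc r t₀ ≤ TW r N (-t₂) := by
    have h1 := hslope (-t₂) t₀ ⟨le_rfl, by linarith [ht₂0]⟩ ht₀I ht₀I.1
    have hgap : μ₀ * (t₂ - η) ≤ μ₀ * (t₀ - (-t₂)) := by
      have : -η ≤ t₀ := by rw [← habs0]; exact neg_abs_le t₀
      exact mul_le_mul_of_nonneg_left (by linarith) hμ.le
    have h3 := (abs_le.1 hdevW).2
    linarith
  -- IVT
  obtain ⟨t₀', ht₀'I, hTWt₀'⟩ : ∃ t ∈ Icc (-t₂) t₂, TW r N t = Wloc r t₀ :=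
    intermediate_value_Icc' (by linarith) hcont ⟨hlow, hhigh⟩
  -- `|t₀' - t₀| ≤ E / μ₀ ≤ η / 2`
  have hdist : μ₀ * |t₀' - t₀| ≤ E := by
    rcases le_total t₀ t₀' with h | h
    · have h1 := hslope t₀ t₀' ht₀I ht₀'I h
      rw [hTWt₀'] at h1
      rw [abs_of_nonneg (by linarith)]
      have h3 := (abs_le.1 hdevW).1
      have e : μ₀ * (t₀' - t₀) = -(-μ₀ * (t₀' - t₀)) := by ring
      linarith
    · have h1 := hslope t₀' t₀ ht₀'I ht₀I h
      rw [hTWt₀'] at h1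
      rw [abs_of_nonpos (by linarith)]
      have h3 := (abs_le.1 hdevW).2
      have e : μ₀ * -(t₀' - t₀) = -(-μ₀ * (t₀ - t₀')) := by ring
      linarith
  have hdist' : |t₀' - t₀| ≤ η / 2 := by
    have := hdist.trans hEμ
    exact le_of_mul_le_mul_left (by linarith) hμ
  -- consequences for `s t₀'`
  have hsd : |s * t₀' - η| ≤ η / 2 := by
    have : s * t₀' - η = s * (t₀' - t₀) := by rw [← hst₀]; ring
    rw [this, abs_mul, hs1, one_mul]; exact hdist'
  have hpos : 0 < s * t₀' := by linarith [(abs_le.1 hsd).1]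
  have hlt : s * t₀' < t₁ := by linarith [(abs_le.1 hsd).2]
  have habs' : η / 2 ≤ |t₀'| := by
    have : |s * t₀'| = |t₀'| := by rw [abs_mul, hs1, one_mul]
    rw [← this]
    have := (abs_le.1 hsd).1
    rw [abs_of_pos hpos]; linarith
  -- `v₀` and its bound
  set v₀ : ℝ := Zloc r t₀ - TZ r N t₀' with hv₀
  have hLip : |TZ r N t₀ - TZ r N t₀'| ≤ L * |t₀ - t₀'| := by
    have h := (convex_Icc (-t₂) t₂).norm_image_sub_le_of_norm_deriv_le (f := TZ r N) (C := L)
      (fun t _ => (hasDerivAt_TZ r N t).differentiableAt) ?_ ht₀'I ht₀I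
    · simpa [Real.norm_eq_abs] using h
    · intro t ht
      rw [(hasDerivAt_TZ r N t).deriv, Real.norm_eq_abs]; exact hTZ' t ht
  have hv₀b : |v₀| ≤ E * (1 + L / μ₀) := by
    have e : v₀ = (Zloc r t₀ - TZ r N t₀) + (TZ r N t₀ - TZ r N t₀') := by rw [hv₀]; ring
    rw [e]
    refine (abs_add_le _ _).trans ?_
    have h2 : L * |t₀ - t₀'| ≤ L * (E / μ₀) := by
      rw [abs_sub_comm]
      have : |t₀' - t₀| ≤ E / μ₀ := by rw [le_div_iff₀ hμ]; linarith
      gcongr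
    have e2 : E + L * (E / μ₀) = E * (1 + L / μ₀) := by field_simp
    linarith [hLip.trans h2]
  have hfin : E * (1 + L / μ₀) < β * t₀' ^ 4 := by
    set A : ℝ := 1 + L / μ₀ with hA
    have hA1 : 1 ≤ A := by rw [hA]; have := div_nonneg hL0 hμ.le; linarith
    have hη4 : (η / 2) ^ 4 ≤ t₀' ^ 4 := by
      have h := pow_le_pow_left₀ (by positivity) habs' 4
      have e : |t₀'| ^ 4 = t₀' ^ 4 := by
        rw [show (4 : ℕ) = 2 * 2 from rfl, pow_mul, pow_mul, sq_abs]
      rwa [e] at h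
    have hred : 32 * K₀ * A * M₀ ^ 4 * (1 / 2048) ^ m < β := by
      have e2 : (1 / 2048 : ℝ) ^ m * 2048 ^ m = 1 := by rw [← mul_pow]; norm_num
      have h := mul_lt_mul_of_pos_right hsmall (show (0:ℝ) < (1 / 2048) ^ m by positivity)
      calc 32 * K₀ * A * M₀ ^ 4 * (1 / 2048) ^ m < β * 2048 ^ m * (1 / 2048) ^ m := h
        _ = β * ((1 / 2048 : ℝ) ^ m * 2048 ^ m) := by ring
        _ = β := by rw [e2, mul_one]
    -- `E A = 2 K₀ A (M₀η)^m (M₀η)^4 ≤ 2 K₀ A (1/2048)^m M₀^4 η^4 < β η^4 / 16`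
    have hsplit : E * A = 2 * K₀ * A * (M₀ * η) ^ m * (M₀ ^ 4 * η ^ 4) := by
      rw [hEdef, hm, show m + 3 + 1 = m + 4 by ring, pow_add, mul_pow]; ring
    have hle : E * A ≤ 2 * K₀ * A * (1 / 2048) ^ m * (M₀ ^ 4 * η ^ 4) := by
      rw [hsplit]
      have : 2 * K₀ * A * (M₀ * η) ^ m ≤ 2 * K₀ * A * (1 / 2048) ^ m := by
        have hA0 : 0 ≤ 2 * K₀ * A := by nlinarith
        exact mul_le_mul_of_nonneg_left (hpowle m) hA0
      exact mul_le_mul_of_nonneg_right this (by positivity)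
    have hkey : E * A < β * (η / 2) ^ 4 := by
      have e3 : β * (η / 2) ^ 4 = (β / 16) * η ^ 4 := by ring
      have e4 : 2 * K₀ * A * (1 / 2048) ^ m * (M₀ ^ 4 * η ^ 4) =
          ((32 * K₀ * A * M₀ ^ 4 * (1 / 2048) ^ m) / 16) * η ^ 4 := by ring
      rw [e3]; rw [e4] at hle
      have hη4pos : 0 < η ^ 4 := by positivity
      have : (32 * K₀ * A * M₀ ^ 4 * (1 / 2048) ^ m) / 16 * η ^ 4 < β / 16 * η ^ 4 :=
        mul_lt_mul_of_pos_right (by linarith) hη4pos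
      linarith
    calc E * (1 + L / μ₀) = E * A := by rw [hA]
      _ < β * (η / 2) ^ 4 := hkey
      _ ≤ β * t₀' ^ 4 := by
          have hβ : 0 ≤ β := by
            have : 0 < 32 * K₀ * A * M₀ ^ 4 * (1 / 2048) ^ m := by positivity
            linarith
          exact mul_le_mul_of_nonneg_left hη4 hβ
  refine ⟨t₀', v₀, hTWt₀', by rw [hv₀]; ring, hpos, hlt, lt_of_le_of_lt hv₀b hfin, ?_, ht₀'I⟩
  -- `η < sonicRad r = 1/(2 geoM)`
  rw [habs0]
  unfold sonicRad
  rw [lt_div_iff₀ (by positivity)]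
  nlinarith

end Monatomic

end BuckmasterCaolaboraGomezserrano2025

end Literature.Analysis.FluidPDE
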